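import Summits.QuantumFields.YangMills.Theorems.BalabanUVNodesN12AtRecord13OfResiduals
import Literature.MathematicalPhysics.QuantumFieldTheory.Balaban1983to89.Node00.Record13CarriersSepCoPR
import Literature.MathematicalPhysics.QuantumFieldTheory.Balaban1983to89.Node00.Record13SepCoPRInhabitedOfSepCoP

/-!
# BalabanUVNodes ∕ N12 — N12's STAGE-13 STOREY AT THE v1.6 `CoPR` CORE RECORD (node00-def-T FILE 25 `Node00/Record13CoPR`, p529474: `structure Stage13RParams extends Stage13Params`
# with the RUN-INDEXED residual 𝐓-weight slot `Zr` — director-ym №169 H1 ∕ №174, FINDING №8; rev 22, cluster K1: K1⁶ `StabilityBAtRecordR13SepCoPR` = stmt-QuantumFields-20507) — the by-hand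
# port of this seat's 12J-CoP `BalabanUVNodesN12AtRecord13CoP` (p523316) to `IsRecordOfRecord₁₃CCoPR` ∕ `datumOfRecord₁₃CoPR` ∕ `toStage5₁₃CoPR` over dag-n10-d's R-LEVEL PINS
# (`Record13CarriersCoPR` p530591: `Stage13RParams.pinW`, `Provisos₁₃CoPR.pinW`, `datumOfRecord₁₃CoPR_pinW` rfl, `toStage5₁₃CoPR_pinW` rfl), the live layer at dag-n11-e's RUN-INDEXED
# EXTENSION `⟨Θ.liveRepin₁₃, Zr⟩` (`B16RLeafRecord13LiveCoPR` §2, `Zr` free) and at node00-def-K0a's CURED PIN `Stage13RParams.ofCured F N (Θ.liveRepin₁₃ F N)` (FILE 18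
# `Record13SepCoPRInhabitedOfSepCoP` p531386: `Zr := ZrOfRecord₁₃`, `zrUnity_ofCured`, `Provisos₁₃Core.ofCured`) (Track A, DAG node N12 = [B15, Balaban1989LargeFieldI] CMP **122** (1989) 175–202;
# seat `pub-ymgap-dag-n12-d` g11 (R134 s2 «knit at the record»), 2026-08-27; count-neutral, NOT a discharge)

HONEST FRAMING.  Count-neutral kernel RE-KEYING BY NAME.  The v1.6 edition changes the TYPE of the record's parameter (`Stage13Params ↦ Stage13RParams`, one new field `Zr`); N12 READS
NEITHER `Zr` NOR any 𝐓-weight: every N12 ROW of this seat (12E ∕ 14C ∕ 12F ∕ 12I ∕ 12L ∕ 12N ∕ 12P ∕ 12Q′) is a statement about `B15Leaf (WOfRecord₁₃ θ λ P)` over a θ-LEVEL parameter and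
applies at an R-parameter `θR` through `θR.toStage13Params` — at the extension `⟨Θ.liveRepin₁₃, Zr⟩` that IS `Θ.liveRepin₁₃` by `rfl`, so 12E's proviso-free ★★ row
`b15Leaf_WOfRecord₁₃_liveRepin₁₃_of_massLive_of_hasResiduals` feeds the storey VERBATIM.  What re-keys is the record side only: the W-pin is dag-n10-d's R-level `Stage13RParams.pinW`
(`onBase`, `Zr` kept), its CORE proviso face `Provisos₁₃CoPR.pinW`, the datum ∕ Stage-5-view identities (`rfl`), node00-def-T's eight-tuple `IsRecordOfRecord₁₃CCoPR` (clause order identical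
to every edition).  The K1⁶ GUARD gains the conjunct `ZrUnity`: DISPLAYED (`hZr`) at a generic extension, a THEOREM at node00-def-K0a's cured pin (`zrUnity_ofCured`, hypothesis-free), where
moreover the v1.6 core provisos ARE the v1.5 ones (`Provisos₁₃Core.ofCured`) — so AT THE CURED PIN N12's v1.6 STOREY COSTS EXACTLY ITS v1.5 INPUTS.  Nothing of Bałaban's is asserted or
proved; NO estimate; the (1.100) pin equation, live-mass (NODE 00), Proposition 1 (1.78), (1.80), (1.89) stay DISPLAYED per run below the torus; N12 is NOT discharged; counts unmoved
(Track A discharged 5∕28).  The ITEM-FACING shapes of K1⁶'s registered v4 rung `NodesAtSomeRecord13PWS` (S-BOUND world, `RecordS`) are the sequel `…N12AtRecord13SepCoPRS`; the full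
rung body (all thirteen nodes) waits on dag-n24-c's v1.6 four-pin engine.  ONE finite four-torus programme at fixed `ε = L^{-K}` — nothing continuum ∕ ℝ⁴ ∕ OS ∕ mass gap ∕ Clay.

WHAT THIS FILE GIVES (all count-neutral):
* §1 THE STOREY AT THE v1.6 CORE RECORD (generic `θ : Stage13RParams`, `h : Provisos₁₃CoPR`): `exists_record₁₃CCoPR_pinWWorld_b15_main_of_leaf`, census `exists_pinWWorld_b15_main_degenerate`,
  `…_of_leafOfRecord` (W at the bundle of record `WOfRecord₁₃ θ.toStage13Params λ`).
* §2 THE MIXED W-PIN at the v1.6 core record: `exists_mixedPinW_record₁₃CCoPR_b15_main_of_leafBelow` — NO `K ≤ kSel P` leaf.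
* §3 AT THE RUN-INDEXED EXTENSION `⟨Θ.liveRepin₁₃, Zr⟩` of the live re-pin of a `Θ` carrying node00-def-K0b's residuals (`Zr` free): ★ `exists_mixedPinW_record₁₃CCoPR_b15_main_liveRepin₁₃R_of_massLive_of_hasResiduals`
  (N12's row from its per-run displays), ★★ `exists_guarded_record₁₃CCoPR_b15_main_liveRepin₁₃R_of_massLive_of_hasResiduals_below` (the rung-1 N12-only ∃-shape at the CORE record; `hZr` displayed).
* §4 AT THE CURED PIN `Stage13RParams.ofCured F N (Θ.liveRepin₁₃ F N)`: ★★ `exists_guarded_record₁₃CCoPR_b15_main_ofCured_liveRepin₁₃_of_massLive_of_hasResiduals_below` (`ZrUnity` DISCHARGED; edition-side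
  input the v1.5 `h : (Θ.liveRepin₁₃).Provisos₁₃Core`); §5 ★★★ `…_ofCured_theta13OfThm1C_…_below` (at `θ₁₅ᶜ`).

Sources: [Balaban1989LargeFieldI] (0.2)–(0.6) p.176, p.176 ll.14–16, Prop. 1 (1.78) p.194, (1.80) p.195, (1.89) p.198, (1.99)–(1.102) pp.200–201; [Balaban1988Convergent] (1.11) p.248, (2.18) p.257,
(3.16)–(3.25) pp.268–270; [Balaban1989LargeFieldII] Thm 1 + (0.1) pp.355–356 (the record; bookkeeping).
-/

noncomputable section

open MeasureTheory
open scoped Matrix.Norms.L2Operator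

namespace Summit.QuantumFields.YangMills.BalabanUVNodes.N12AtRecord13CoPR

open Literature.MathematicalPhysics.QuantumFieldTheory.Balaban1983to89
open Literature.MathematicalPhysics.QuantumFieldTheory.Balaban1983to89.T4Continuum (T4Family)
open Literature.MathematicalPhysics.QuantumFieldTheory.Balaban1983to89.DagBinding
open Literature.MathematicalPhysics.QuantumFieldTheory.Balaban1983to89.Node00
open B15Claim189Assembly (new189 chiPP dom)
open B15 (Prop1Printed Ineq180)
open B15.BasicStep (Claim189)
open B8Eq17ClassAkV1 (plaqsOf)
open B15RPrime1100OfRep (rPrimeDataOfSel)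
open Summit.QuantumFields.YangMills.BalabanUVNodes.N12AtRecord13OfResiduals (b15Leaf_WOfRecord₁₃_liveRepin₁₃_of_massLive_of_hasResiduals)

variable {N : ℕ} [NeZero N] {F : T4Family}

/-! ## §1 N12's ₁₃ STOREY AT THE v1.6 CORE RECORD — «an `IsRecordOfRecord₁₃CCoPR` record of θ's OWN `datumOfRecord₁₃CoPR` with `Dag.B15_main` at every run» at the C-binding of the
W-PINNED Stage-13 view of an R-parameter (dag-n10-d's R-level `pinW`), W READ AT THE BUNDLE OF RECORD -/

section Storey
variable (θ : Stage13RParams F N)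

/-- **FOR EVERY ADMISSIBLE v1.6 STAGE-13 PACKAGE WITH THE CORE PROVISOS AND ANY PER-RUN [IV] BUNDLE FAMILY `W₀` CARRYING THE LEAF, THE WORLD BOUND AT THE C-BINDING OF THE W-PINNED
STAGE-13 VIEW IS A v1.6 CORE ₁₃C RECORD OF θ's OWN CORE DATUM WITH `Dag.B15_main` AT EVERY RUN** (any window `γw ∈ ]0, θ.γ]`, block size `θ.L`; the pin is UP-SIDE — dag-n10-d's
R-level `Stage13RParams.pinW` (`onBase`: the run-indexed residual `Zr` kept) with its CORE face `Provisos₁₃CoPR.pinW` (the datum pin `datumOfRecord₁₃CoPR_pinW` and the view identity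
`toStage5₁₃CoPR_pinW` are `rfl`), `Stage13Params.pinW_admissible_iff` at `θ.toStage13Params`, node00-def-T's eight-tuple `IsRecordOfRecord₁₃CCoPR` (FILE 25); N12 reads `W₀` there: g30's
`upOfRecord₅C_pinW_rBasicStep_iff`).  HONESTY (R433 species, this seat's g4 `exists_printedCarriers15_b15Leaf`): at a GENERIC `W₀` the leaf is junk-inhabitable — the contentful instances
read `W₀ := WOfRecord₁₃ θ.toStage13Params λ` (below).  Every v1.6 edition's package `h` reads this at `h.toCore` (same datum, `rfl`); count-neutral.
[cite: Balaban1989LargeFieldI, (0.2)–(0.6) p.176, Prop. 1 p.194; Balaban1989LargeFieldII, Thm 1 + (0.1) pp.355–356 (the record; bookkeeping)] -/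
theorem exists_record₁₃CCoPR_pinWWorld_b15_main_of_leaf (h : θ.Provisos₁₃CoPR F N) (hθ : θ.Admissible F N) (W₀ : B12.RunParams → PrintedCarriers15)
    {γw : ℝ} (hγw : 0 < γw ∧ γw ≤ θ.γ) (hleaf : ∀ P, B15Leaf (W₀ P)) :
    ∃ w : WorldP, IsRecordOfRecord₁₃CCoPR F N (datumOfRecord₁₃CoPR F N θ h) w ∧ w.γ = γw ∧ w.L = (θ.L : ℝ) ∧
      (∀ P, w.up P = upOfRecord₅C F N ((θ.pinW F N W₀).toStage5₁₃CoPR F N) P) ∧ ∀ P : B12.RunParams, Dag.B15_main (leavesP w P) := by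
  obtain ⟨w₀⟩ := nonempty_worldP
  let w : WorldP :=
    { w₀ with
      C := (datumOfRecord₁₃CoPR F N θ h).C, γ := γw, L := (θ.L : ℝ), one_lt_L := by exact_mod_cast θ.hL.2,
      up := fun P => upOfRecord₅C F N ((θ.pinW F N W₀).toStage5₁₃CoPR F N) P }
  refine ⟨w, ⟨θ.pinW F N W₀, h.pinW W₀, (Stage13Params.pinW_admissible_iff F N θ.toStage13Params W₀).2 hθ, rfl, rfl, hγw, rfl,
    fun _ => rfl⟩, rfl, rfl, fun _ => rfl, fun P => ?_⟩
  exact B15LeafKnit.b15_main_of_up (U := upOfRecord₅C F N ((θ.pinW F N W₀).toStage5₁₃CoPR F N) P) rfl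
    ((upOfRecord₅C_pinW_rBasicStep_iff F N (θ.toStage5₁₃CoPR F N) W₀ P).2 (hleaf P))

/-- **CENSUS (R433 species, kernel form): THE GENERIC-`W₀` STOREY IS JUNK-INHABITABLE AT EVERY ADMISSIBLE v1.6 CORE PACKAGE** — a DEGENERATE [IV] bundle carries `B15Leaf` (this seat's g4
`exists_printedCarriers15_b15Leaf`), so SOME `W₀` presents a v1.6 core record of `datumOfRecord₁₃CoPR θ h` with `Dag.B15_main` at every run WITHOUT any [IV] input.  Hence only the forms
with W read AT THE BUNDLE OF RECORD (below) measure N12. [cite: Balaban1989LargeFieldI, (0.2) p.176, Prop. 1 p.194 (bookkeeping: the typed conjuncts read the carrier)] -/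
theorem exists_pinWWorld_b15_main_degenerate (h : θ.Provisos₁₃CoPR F N) (hθ : θ.Admissible F N) {γw : ℝ} (hγw : 0 < γw ∧ γw ≤ θ.γ) :
    ∃ (W₀ : B12.RunParams → PrintedCarriers15) (w : WorldP), IsRecordOfRecord₁₃CCoPR F N (datumOfRecord₁₃CoPR F N θ h) w ∧ w.γ = γw ∧ w.L = (θ.L : ℝ) ∧
      (∀ P, w.up P = upOfRecord₅C F N ((θ.pinW F N W₀).toStage5₁₃CoPR F N) P) ∧ ∀ P : B12.RunParams, Dag.B15_main (leavesP w P) := by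
  obtain ⟨W, hW⟩ := N12AtRecord12Pointed.exists_printedCarriers15_b15Leaf (F.P 0)
  exact ⟨fun _ => W, exists_record₁₃CCoPR_pinWWorld_b15_main_of_leaf θ h hθ (fun _ => W) hγw fun _ => hW⟩

/-- **… W READ AT THE BUNDLE OF RECORD `WOfRecord₁₃ θ.toStage13Params λ`** (dag-n10-d's `Record13Carriers.WOfRecord₁₃` — θ-level, NOT re-issued at v1.6 (node00-def-T g19 Q3): n12-a's `WOfRepr` at
`Tstep rep_k` of record, the selector and the fibres along the ₁₃ histories): the N12 row HANDED run by run. [cite: Balaban1989LargeFieldI, (0.2)–(0.6) p.176, Prop. 1 p.194, (1.80), (1.89), (1.99)–(1.102); Balaban1989LargeFieldII, Thm 1 + (0.1) pp.355–356 (bookkeeping)] -/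
theorem exists_record₁₃CCoPR_pinWWorld_b15_main_of_leafOfRecord (h : θ.Provisos₁₃CoPR F N) (hθ : θ.Admissible F N) (lamW : ResidW F N)
    {γw : ℝ} (hγw : 0 < γw ∧ γw ≤ θ.γ) (h12 : ∀ P, B15Leaf (WOfRecord₁₃ F N θ.toStage13Params lamW P)) :
    ∃ w : WorldP, IsRecordOfRecord₁₃CCoPR F N (datumOfRecord₁₃CoPR F N θ h) w ∧ w.γ = γw ∧ w.L = (θ.L : ℝ) ∧
      (∀ P, w.up P = upOfRecord₅C F N ((θ.pinW F N (WOfRecord₁₃ F N θ.toStage13Params lamW)).toStage5₁₃CoPR F N) P) ∧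
        ∀ P : B12.RunParams, Dag.B15_main (leavesP w P) :=
  exists_record₁₃CCoPR_pinWWorld_b15_main_of_leaf θ h hθ (WOfRecord₁₃ F N θ.toStage13Params lamW) hγw h12

end Storey

/-! ## §2 THE MIXED W-PIN AT THE v1.6 CORE RECORD — the bundle of record below the torus, a degenerate leaf-carrier on runs whose selected step is not a printed step (`P.K ≤ λ.kSel P`):
N12's storey WITHOUT the `K ≤ kSel P` leaf -/

section BelowTorus
variable (θ : Stage13RParams F N)

/-- **THE MIXED W-PIN ENGINE AT THE v1.6 CORE RECORD**: for every admissible v1.6 Stage-13 package with the core provisos and every residual layer `λ` whose bundle of record carries the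
leaf on the runs `P` with `λ.kSel P < P.K` (the runs where step `λ.kSel P` IS one of print's `K` steps), there is a run-indexed [IV] bundle family `W₀` AGREEING WITH THE BUNDLE OF
RECORD `WOfRecord₁₃ θ.toStage13Params λ P` ON THOSE RUNS, carrying the leaf at every run, whose W-pinned world is a v1.6 core record of `datumOfRecord₁₃CoPR θ h` with `Dag.B15_main` at
every run.  On the other runs (`P.K ≤ λ.kSel P`: at `K = 0` there is no step) `W₀ P` is the degenerate leaf-carrier of this seat's g4 `exists_printedCarriers15_b15Leaf`, where print
applies no basic step.  HONESTY: this removes a junk demand, not a printed one; the per-run cost below the torus is unchanged. [cite: Balaban1989LargeFieldI, (0.1)–(0.6) pp.175–176 (the basic step is applied at the steps `k < K` of a run), Prop. 1 p.194; Balaban1989LargeFieldII, Thm 1 + (0.1) pp.355–356 (bookkeeping)] -/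
theorem exists_mixedPinW_record₁₃CCoPR_b15_main_of_leafBelow (h : θ.Provisos₁₃CoPR F N) (hθ : θ.Admissible F N) (lamW : ResidW F N)
    {γw : ℝ} (hγw : 0 < γw ∧ γw ≤ θ.γ) (h12 : ∀ P : B12.RunParams, lamW.kSel P < P.K → B15Leaf (WOfRecord₁₃ F N θ.toStage13Params lamW P)) :
    ∃ W₀ : B12.RunParams → PrintedCarriers15, (∀ P : B12.RunParams, lamW.kSel P < P.K → W₀ P = WOfRecord₁₃ F N θ.toStage13Params lamW P) ∧ (∀ P, B15Leaf (W₀ P)) ∧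
      ∃ w : WorldP, IsRecordOfRecord₁₃CCoPR F N (datumOfRecord₁₃CoPR F N θ h) w ∧ w.γ = γw ∧ w.L = (θ.L : ℝ) ∧
        (∀ P, w.up P = upOfRecord₅C F N ((θ.pinW F N W₀).toStage5₁₃CoPR F N) P) ∧ ∀ P : B12.RunParams, Dag.B15_main (leavesP w P) := by
  obtain ⟨Wd, hWd⟩ := N12AtRecord12Pointed.exists_printedCarriers15_b15Leaf (F.P 0)
  have hleaf : ∀ P : B12.RunParams, B15Leaf ((fun P : B12.RunParams => if lamW.kSel P < P.K then WOfRecord₁₃ F N θ.toStage13Params lamW P else Wd) P) := fun P => by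
    dsimp only
    split_ifs with hP
    exacts [h12 P hP, hWd]
  exact ⟨_, fun P hP => if_pos hP, hleaf, exists_record₁₃CCoPR_pinWWorld_b15_main_of_leaf θ h hθ _ hγw hleaf⟩

end BelowTorus

/-! ## §3 AT THE RUN-INDEXED EXTENSION `⟨Θ.liveRepin₁₃, Zr⟩` OF THE LIVE RE-PIN OF A PARAMETER CARRYING K0b's RESIDUALS (dag-n11-e's convention, `B16RLeafRecord13LiveCoPR` §2: `Zr` FREE, so that
node00-def-K0a's cured pin `ofCured` and node00-def-T's run-blind embedding `ofRunBlind` are instances by `rfl`) — N12's row from its per-run displays by 12E, since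
`(⟨Θ.liveRepin₁₃, Zr⟩ : Stage13RParams).toStage13Params = Θ.liveRepin₁₃` by `rfl` -/

section LiveExtension
variable (Θ : Stage13Params F N) (Zr : (q : B12.RunParams) → TkResidualW F N (FluctV N) q.K) (lamW : ResidW F N)

/-- **★ N12's v1.6 CORE STOREY AT THE RUN-INDEXED EXTENSION OF THE ₁₃ LIVE RE-PIN, MIXED W-PIN — NO `K ≤ kSel P` LEAF**: at `⟨Θ.liveRepin₁₃, Zr⟩` for a `Θ` carrying K0b's residuals
and ANY run-indexed residual `Zr`, N12's row on the runs below the torus from 12E's per-run ★★ `b15Leaf_WOfRecord₁₃_liveRepin₁₃_of_massLive_of_hasResiduals` (the (1.100) pin equation +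
«every LIVE pre-𝐑 term at level `kSel P + 1` has positive mass» + Prop. 1 (1.78) + (1.80) + (1.89)), the other runs served by the degenerate carrier (§2 engine).  Edition-side input:
`h : Provisos₁₃CoPR` AT THE EXTENSION (i.e. `hE.toCore` of the closer's v1.6 package; its rows `zrLaws ∕ zrLocal` are the only clauses reading `Zr` — for the datum and the record predicate
ONLY) and admissibility of `Θ`.  N12 reads no 𝐓-weight. [cite: Balaban1989LargeFieldI, (0.2)–(0.6) p.176, p.176 ll.14–16, Prop. 1 (1.78) p.194, (1.80) p.195, (1.89) p.198, (1.99)–(1.102) pp.200–201; Balaban1988Convergent, (1.11) p.248, (3.16) p.268, (3.22)–(3.25) pp.269–270; Balaban1989LargeFieldII, Thm 1 + (0.1) pp.355–356] -/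
theorem exists_mixedPinW_record₁₃CCoPR_b15_main_liveRepin₁₃R_of_massLive_of_hasResiduals (hres : Θ.HasResidualsOfRecord F N)
    (h : (⟨Θ.liveRepin₁₃ F N, Zr⟩ : Stage13RParams F N).Provisos₁₃CoPR F N) (hθ : Θ.Admissible F N) {γw : ℝ} (hγw : 0 < γw ∧ γw ≤ Θ.γ)
    (h12pin : ∀ P : B12.RunParams, lamW.kSel P < P.K → lamW.D1100 P
      = rPrimeDataOfSel (reprTOfRecord₁₃ F N (Θ.liveRepin₁₃ F N) P (lamW.kSel P))
          ((Θ.liveRepin₁₃ F N).ppSel P (gOfRecord₁₃ F N (Θ.liveRepin₁₃ F N) P) (lamW.kSel P + 1))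
          (fibOfSeq F (Θ.liveRepin₁₃ F N).ν (Θ.liveRepin₁₃ F N).τ9 P (gOfRecord₁₃ F N (Θ.liveRepin₁₃ F N) P) (lamW.kSel P + 1)))
    (h12mass : ∀ P : B12.RunParams, lamW.kSel P < P.K → ∀ s, LiveSeq F N Θ.ν Θ.τ9 P (gOfRecord₁₃ F N (Θ.liveRepin₁₃ F N) P) (lamW.kSel P + 1)
        (slotsTOfRecord F N Θ.ν Θ.τ9 (EOfRecord₁₃ F N (Θ.liveRepin₁₃ F N)) (wOfRecord₉ F N (Θ.liveRepin₁₃ F N).toStage9Params)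
          (Θ.liveRepin₁₃ F N).ppSel P (gOfRecord₁₃ F N (Θ.liveRepin₁₃ F N) P) (lamW.kSel P + 1)) s →
      0 < ∫ V, rterm (reprTOfRecord₁₃ F N (Θ.liveRepin₁₃ F N) P (lamW.kSel P)) s V ∂(fieldMeasure (F.P P.K) (lamW.kSel P + 1) (SU N)))
    (h12P1 : ∀ P : B12.RunParams, lamW.kSel P < P.K → Prop1Printed (lamW.LF P))
    (h12i180 : ∀ P : B12.RunParams, lamW.kSel P < P.K → ∀ U, new189 (lamW.D189 P) U → ∀ i, (lamW.D189 P).h ≤ i → i ≤ (lamW.D189 P).k →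
      ∀ q ∈ plaqsOf (dom (lamW.D189 P) i),
        Ineq180 ((lamW.D189 P).dev0 U q) ((lamW.D189 P).ε (lamW.D189 P).k) (lamW.D189 P).η (lamW.D189 P).B₃ (lamW.D189 P).B₅ (lamW.D189 P).M (lamW.D189 P).δ
          ((lamW.D189 P).dist q) (lamW.D189 P).O1)
    (h12c189 : ∀ P : B12.RunParams, lamW.kSel P < P.K → Claim189 (new189 (lamW.D189 P)) (chiPP (lamW.D189 P))) :
    ∃ W₀ : B12.RunParams → PrintedCarriers15, (∀ P : B12.RunParams, lamW.kSel P < P.K → W₀ P = WOfRecord₁₃ F N (Θ.liveRepin₁₃ F N) lamW P) ∧ (∀ P, B15Leaf (W₀ P)) ∧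
      ∃ w : WorldP, IsRecordOfRecord₁₃CCoPR F N (datumOfRecord₁₃CoPR F N (⟨Θ.liveRepin₁₃ F N, Zr⟩ : Stage13RParams F N) h) w ∧ w.γ = γw ∧ w.L = (Θ.L : ℝ) ∧
        (∀ P, w.up P = upOfRecord₅C F N (((⟨Θ.liveRepin₁₃ F N, Zr⟩ : Stage13RParams F N).pinW F N W₀).toStage5₁₃CoPR F N) P) ∧
          ∀ P : B12.RunParams, Dag.B15_main (leavesP w P) :=
  exists_mixedPinW_record₁₃CCoPR_b15_main_of_leafBelow (⟨Θ.liveRepin₁₃ F N, Zr⟩ : Stage13RParams F N) h hθ.liveRepin₁₃ lamW hγw fun P hk =>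
    b15Leaf_WOfRecord₁₃_liveRepin₁₃_of_massLive_of_hasResiduals Θ lamW hres hk (h12pin P hk) (h12mass P hk) (h12P1 P hk) (h12i180 P hk) (h12c189 P hk)

/-- **★★ THE RUNG-1 ∃-SHAPE AT THE v1.6 CORE RECORD (K1⁶'s guard `ZrUnity ∧ SlotsNondegenerate₁₃` — NOT an item text: items key on the `SepCoPR` edition and bind the world by `RecordS`),
N12's CONJUNCT ONLY, WITNESSED BY `(⟨Θ.liveRepin₁₃, Zr⟩, h, w)` — NO `K ≤ kSel P` LEAF**: `∃ θ' h' w, (ZrUnity ∧ SlotsNondegenerate₁₃) ∧ Admissible ∧ IsRecordOfRecord₁₃CCoPR (datumOfRecord₁₃CoPR θ' h') w ∧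
∀ P, Dag.B15_main (leavesP w P)`; the slots guard a THEOREM of K0b's residuals (node00-def-K0a FILE 9 v1.1 `slotsNondegenerate₁₃_liveRepin_of_hasResiduals` — read through `toStage13Params`),
print's partition of unity of the run-indexed residual DISPLAYED (`hZr`; a theorem at the cured pin, §4).  N12 ALONE at its own world; NOT the stub; count-neutral.
[cite: Balaban1989LargeFieldI, (0.2)–(0.6) p.176, Prop. 1 (1.78) p.194, (1.80) p.195, (1.89) p.198, (1.99)–(1.102) pp.200–201; Balaban1988Convergent, (1.11) p.248, (3.16)–(3.22) pp.268–269 (the guard); Balaban1989LargeFieldII, Thm 1 + (0.1) pp.355–356 (bookkeeping)] -/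
theorem exists_guarded_record₁₃CCoPR_b15_main_liveRepin₁₃R_of_massLive_of_hasResiduals_below (hres : Θ.HasResidualsOfRecord F N)
    (h : (⟨Θ.liveRepin₁₃ F N, Zr⟩ : Stage13RParams F N).Provisos₁₃CoPR F N) (hθ : Θ.Admissible F N) (hZr : (⟨Θ.liveRepin₁₃ F N, Zr⟩ : Stage13RParams F N).ZrUnity F N)
    (h12pin : ∀ P : B12.RunParams, lamW.kSel P < P.K → lamW.D1100 P
      = rPrimeDataOfSel (reprTOfRecord₁₃ F N (Θ.liveRepin₁₃ F N) P (lamW.kSel P))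
          ((Θ.liveRepin₁₃ F N).ppSel P (gOfRecord₁₃ F N (Θ.liveRepin₁₃ F N) P) (lamW.kSel P + 1))
          (fibOfSeq F (Θ.liveRepin₁₃ F N).ν (Θ.liveRepin₁₃ F N).τ9 P (gOfRecord₁₃ F N (Θ.liveRepin₁₃ F N) P) (lamW.kSel P + 1)))
    (h12mass : ∀ P : B12.RunParams, lamW.kSel P < P.K → ∀ s, LiveSeq F N Θ.ν Θ.τ9 P (gOfRecord₁₃ F N (Θ.liveRepin₁₃ F N) P) (lamW.kSel P + 1)
        (slotsTOfRecord F N Θ.ν Θ.τ9 (EOfRecord₁₃ F N (Θ.liveRepin₁₃ F N)) (wOfRecord₉ F N (Θ.liveRepin₁₃ F N).toStage9Params)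
          (Θ.liveRepin₁₃ F N).ppSel P (gOfRecord₁₃ F N (Θ.liveRepin₁₃ F N) P) (lamW.kSel P + 1)) s →
      0 < ∫ V, rterm (reprTOfRecord₁₃ F N (Θ.liveRepin₁₃ F N) P (lamW.kSel P)) s V ∂(fieldMeasure (F.P P.K) (lamW.kSel P + 1) (SU N)))
    (h12P1 : ∀ P : B12.RunParams, lamW.kSel P < P.K → Prop1Printed (lamW.LF P))
    (h12i180 : ∀ P : B12.RunParams, lamW.kSel P < P.K → ∀ U, new189 (lamW.D189 P) U → ∀ i, (lamW.D189 P).h ≤ i → i ≤ (lamW.D189 P).k →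
      ∀ q ∈ plaqsOf (dom (lamW.D189 P) i),
        Ineq180 ((lamW.D189 P).dev0 U q) ((lamW.D189 P).ε (lamW.D189 P).k) (lamW.D189 P).η (lamW.D189 P).B₃ (lamW.D189 P).B₅ (lamW.D189 P).M (lamW.D189 P).δ
          ((lamW.D189 P).dist q) (lamW.D189 P).O1)
    (h12c189 : ∀ P : B12.RunParams, lamW.kSel P < P.K → Claim189 (new189 (lamW.D189 P)) (chiPP (lamW.D189 P))) :
    ∃ (θ' : Stage13RParams F N) (h' : θ'.Provisos₁₃CoPR F N) (w : WorldP), (θ'.ZrUnity F N ∧ θ'.SlotsNondegenerate₁₃ F N) ∧ θ'.Admissible F N ∧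
      IsRecordOfRecord₁₃CCoPR F N (datumOfRecord₁₃CoPR F N θ' h') w ∧ ∀ P : B12.RunParams, Dag.B15_main (leavesP w P) := by
  obtain ⟨-, -, -, w, hR, -, -, -, hN⟩ := exists_mixedPinW_record₁₃CCoPR_b15_main_liveRepin₁₃R_of_massLive_of_hasResiduals Θ Zr lamW hres h hθ
    ⟨hθ.toStage9.gamma_pos, le_rfl⟩ h12pin h12mass h12P1 h12i180 h12c189
  exact ⟨(⟨Θ.liveRepin₁₃ F N, Zr⟩ : Stage13RParams F N), h, w, ⟨hZr, Stage13Params.slotsNondegenerate₁₃_liveRepin_of_hasResiduals hres⟩, hθ.liveRepin₁₃, hR, hN⟩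

end LiveExtension

/-! ## §4 AT node00-def-K0a's CURED PIN `Stage13RParams.ofCured F N (Θ.liveRepin₁₃ F N) = ⟨Θ.liveRepin₁₃, ZrOfRecord₁₃ F N (Θ.liveRepin₁₃)⟩` (FILE 18; K0b FILE 17's run-indexed residual of
record — dag-n11-d's diagonal cure): `ZrUnity` a THEOREM, the v1.6 core provisos = the v1.5 core provisos (`Provisos₁₃Core.ofCured`) -/

section Cured
variable (Θ : Stage13Params F N) (lamW : ResidW F N)

/-- **★★ THE RUNG-1 ∃-SHAPE AT THE v1.6 CORE RECORD, N12's CONJUNCT ONLY, WITNESSED AT THE CURED PIN OF THE LIVE RE-PIN — `ZrUnity` DISCHARGED** (node00-def-K0a's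
`zrUnity_ofCured`, hypothesis-free; the witness is §3's ★★ at `Zr := ZrOfRecord₁₃ F N (Θ.liveRepin₁₃ F N)`, `rfl`): EDITION-SIDE INPUT = the v1.5 core package
`h : (Θ.liveRepin₁₃).Provisos₁₃Core` (lifted by K0a's `Provisos₁₃Core.ofCured`; read by the datum and the record predicate only) and admissibility of `Θ` — AT THE CURED PIN N12's v1.6
STOREY COSTS EXACTLY ITS v1.5 INPUTS (12J-CoP ★★): N12's per-run displays below the torus.  N12 ALONE; NOT the stub; count-neutral.
[cite: Balaban1989LargeFieldI, (0.2)–(0.6) p.176, Prop. 1 (1.78) p.194, (1.80) p.195, (1.89) p.198, (1.99)–(1.102) pp.200–201; Balaban1988Convergent, (1.11) p.248, (3.16)–(3.22) pp.268–269; Balaban1989LargeFieldII, Thm 1 + (0.1) pp.355–356 (bookkeeping)] -/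
theorem exists_guarded_record₁₃CCoPR_b15_main_ofCured_liveRepin₁₃_of_massLive_of_hasResiduals_below (hres : Θ.HasResidualsOfRecord F N)
    (h : (Θ.liveRepin₁₃ F N).Provisos₁₃Core F N) (hθ : Θ.Admissible F N)
    (h12pin : ∀ P : B12.RunParams, lamW.kSel P < P.K → lamW.D1100 P
      = rPrimeDataOfSel (reprTOfRecord₁₃ F N (Θ.liveRepin₁₃ F N) P (lamW.kSel P))
          ((Θ.liveRepin₁₃ F N).ppSel P (gOfRecord₁₃ F N (Θ.liveRepin₁₃ F N) P) (lamW.kSel P + 1))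
          (fibOfSeq F (Θ.liveRepin₁₃ F N).ν (Θ.liveRepin₁₃ F N).τ9 P (gOfRecord₁₃ F N (Θ.liveRepin₁₃ F N) P) (lamW.kSel P + 1)))
    (h12mass : ∀ P : B12.RunParams, lamW.kSel P < P.K → ∀ s, LiveSeq F N Θ.ν Θ.τ9 P (gOfRecord₁₃ F N (Θ.liveRepin₁₃ F N) P) (lamW.kSel P + 1)
        (slotsTOfRecord F N Θ.ν Θ.τ9 (EOfRecord₁₃ F N (Θ.liveRepin₁₃ F N)) (wOfRecord₉ F N (Θ.liveRepin₁₃ F N).toStage9Params)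
          (Θ.liveRepin₁₃ F N).ppSel P (gOfRecord₁₃ F N (Θ.liveRepin₁₃ F N) P) (lamW.kSel P + 1)) s →
      0 < ∫ V, rterm (reprTOfRecord₁₃ F N (Θ.liveRepin₁₃ F N) P (lamW.kSel P)) s V ∂(fieldMeasure (F.P P.K) (lamW.kSel P + 1) (SU N)))
    (h12P1 : ∀ P : B12.RunParams, lamW.kSel P < P.K → Prop1Printed (lamW.LF P))
    (h12i180 : ∀ P : B12.RunParams, lamW.kSel P < P.K → ∀ U, new189 (lamW.D189 P) U → ∀ i, (lamW.D189 P).h ≤ i → i ≤ (lamW.D189 P).k →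
      ∀ q ∈ plaqsOf (dom (lamW.D189 P) i),
        Ineq180 ((lamW.D189 P).dev0 U q) ((lamW.D189 P).ε (lamW.D189 P).k) (lamW.D189 P).η (lamW.D189 P).B₃ (lamW.D189 P).B₅ (lamW.D189 P).M (lamW.D189 P).δ
          ((lamW.D189 P).dist q) (lamW.D189 P).O1)
    (h12c189 : ∀ P : B12.RunParams, lamW.kSel P < P.K → Claim189 (new189 (lamW.D189 P)) (chiPP (lamW.D189 P))) :
    ∃ (θ' : Stage13RParams F N) (h' : θ'.Provisos₁₃CoPR F N) (w : WorldP), (θ'.ZrUnity F N ∧ θ'.SlotsNondegenerate₁₃ F N) ∧ θ'.Admissible F N ∧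
      IsRecordOfRecord₁₃CCoPR F N (datumOfRecord₁₃CoPR F N θ' h') w ∧ ∀ P : B12.RunParams, Dag.B15_main (leavesP w P) :=
  exists_guarded_record₁₃CCoPR_b15_main_liveRepin₁₃R_of_massLive_of_hasResiduals_below Θ (ZrOfRecord₁₃ F N (Θ.liveRepin₁₃ F N)) lamW hres h.ofCured hθ
    (Stage13RParams.zrUnity_ofCured (Θ.liveRepin₁₃ F N)) h12pin h12mass h12P1 h12i180 h12c189

end Cured

/-! ## §5 AT THE CURED PIN OF THE PLAN's `L`-KEYED WITNESS `θ₁₅ᶜ = theta13OfThm1C F N ε₀ ε₂₉ B₃ a₀ a₁` -/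

section CuredThm1C
variable (ε₀ ε₂₉ B₃ a₀ a₁ : ℝ) (lamW : ResidW F N)

/-- **★★★ THE RUNG-1 ∃-SHAPE AT THE v1.6 CORE RECORD, N12's CONJUNCT ONLY, AT THE CURED PIN OF THE PLAN's WITNESS `Stage13RParams.ofCured F N θ₁₅ᶜ`,
`θ₁₅ᶜ = theta13OfThm1C F N ε₀ ε₂₉ B₃ a₀ a₁`** (§4 at `Θ := theta13OfNumerics … (stage12NumericsOfThm1C F.L ε₀ B₃ a₀ a₁) …`, whose ₁₃ live re-pin IS `θ₁₅ᶜ`; K0b's residuals by K0a's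
`hasResidualsOfRecord_theta13OfNumerics`, admissibility by `admissible_theta13OfNumerics` under the five witness signs; `ZrUnity` by `zrUnity_ofCured`): EDITION-SIDE INPUT = the v1.5
`h : Provisos₁₃Core θ₁₅ᶜ` ALONE.  (The K0⁶ witnesses of record ARE cured pins of such live families — K0a FILE 18 §3–§4.)  N12 ALONE; NOT the stub; count-neutral. [cite: Balaban1989LargeFieldI, (0.2)–(0.6) p.176, Prop. 1 (1.78) p.194, (1.80) p.195, (1.89) p.198, (1.99)–(1.102) pp.200–201; Balaban1988Convergent, (1.11) p.248, (2.10) p.256, (3.16)–(3.22) pp.268–269; Balaban1989LargeFieldII, Thm 1 + (0.1) pp.355–356; Balaban1985Variational, Thm 1 p.279 (witness letters only)] -/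
theorem exists_guarded_record₁₃CCoPR_b15_main_ofCured_theta13OfThm1C_of_massLive_below (hε : 0 < ε₀) (hε' : 0 < ε₂₉) (hB : 0 ≤ B₃) (ha₀ : 0 < a₀) (ha₁ : 0 < a₁)
    (h : (theta13OfThm1C F N ε₀ ε₂₉ B₃ a₀ a₁).Provisos₁₃Core F N)
    (h12pin : ∀ P : B12.RunParams, lamW.kSel P < P.K → lamW.D1100 P
      = rPrimeDataOfSel (reprTOfRecord₁₃ F N (theta13OfThm1C F N ε₀ ε₂₉ B₃ a₀ a₁) P (lamW.kSel P))
          ((theta13OfThm1C F N ε₀ ε₂₉ B₃ a₀ a₁).ppSel P (gOfRecord₁₃ F N (theta13OfThm1C F N ε₀ ε₂₉ B₃ a₀ a₁) P) (lamW.kSel P + 1))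
          (fibOfSeq F (theta13OfThm1C F N ε₀ ε₂₉ B₃ a₀ a₁).ν (theta13OfThm1C F N ε₀ ε₂₉ B₃ a₀ a₁).τ9 P (gOfRecord₁₃ F N (theta13OfThm1C F N ε₀ ε₂₉ B₃ a₀ a₁) P) (lamW.kSel P + 1)))
    (h12mass : ∀ P : B12.RunParams, lamW.kSel P < P.K → ∀ s, LiveSeq F N (theta13OfThm1C F N ε₀ ε₂₉ B₃ a₀ a₁).ν (theta13OfThm1C F N ε₀ ε₂₉ B₃ a₀ a₁).τ9 P (gOfRecord₁₃ F N (theta13OfThm1C F N ε₀ ε₂₉ B₃ a₀ a₁) P) (lamW.kSel P + 1)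
        (slotsTOfRecord F N (theta13OfThm1C F N ε₀ ε₂₉ B₃ a₀ a₁).ν (theta13OfThm1C F N ε₀ ε₂₉ B₃ a₀ a₁).τ9 (EOfRecord₁₃ F N (theta13OfThm1C F N ε₀ ε₂₉ B₃ a₀ a₁)) (wOfRecord₉ F N (theta13OfThm1C F N ε₀ ε₂₉ B₃ a₀ a₁).toStage9Params)
          (theta13OfThm1C F N ε₀ ε₂₉ B₃ a₀ a₁).ppSel P (gOfRecord₁₃ F N (theta13OfThm1C F N ε₀ ε₂₉ B₃ a₀ a₁) P) (lamW.kSel P + 1)) s →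
      0 < ∫ V, rterm (reprTOfRecord₁₃ F N (theta13OfThm1C F N ε₀ ε₂₉ B₃ a₀ a₁) P (lamW.kSel P)) s V ∂(fieldMeasure (F.P P.K) (lamW.kSel P + 1) (SU N)))
    (h12P1 : ∀ P : B12.RunParams, lamW.kSel P < P.K → Prop1Printed (lamW.LF P))
    (h12i180 : ∀ P : B12.RunParams, lamW.kSel P < P.K → ∀ U, new189 (lamW.D189 P) U → ∀ i, (lamW.D189 P).h ≤ i → i ≤ (lamW.D189 P).k →
      ∀ q ∈ plaqsOf (dom (lamW.D189 P) i),
        Ineq180 ((lamW.D189 P).dev0 U q) ((lamW.D189 P).ε (lamW.D189 P).k) (lamW.D189 P).η (lamW.D189 P).B₃ (lamW.D189 P).B₅ (lamW.D189 P).M (lamW.D189 P).δ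
          ((lamW.D189 P).dist q) (lamW.D189 P).O1)
    (h12c189 : ∀ P : B12.RunParams, lamW.kSel P < P.K → Claim189 (new189 (lamW.D189 P)) (chiPP (lamW.D189 P))) :
    ∃ (θ' : Stage13RParams F N) (h' : θ'.Provisos₁₃CoPR F N) (w : WorldP), (θ'.ZrUnity F N ∧ θ'.SlotsNondegenerate₁₃ F N) ∧ θ'.Admissible F N ∧
      IsRecordOfRecord₁₃CCoPR F N (datumOfRecord₁₃CoPR F N θ' h') w ∧ ∀ P : B12.RunParams, Dag.B15_main (leavesP w P) :=
  exists_guarded_record₁₃CCoPR_b15_main_ofCured_liveRepin₁₃_of_massLive_of_hasResiduals_below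
    (theta13OfNumerics F N (stage12NumericsOfThm1C F.L ε₀ B₃ a₀ a₁) ε₂₉
      (zeta316OfRecord F N (stage12NumericsOfThm1C F.L ε₀ B₃ a₀ a₁).ν (stage12NumericsOfThm1C F.L ε₀ B₃ a₀ a₁).τ9.M (stage12NumericsOfThm1C F.L ε₀ B₃ a₀ a₁).A₁)
      (RzOfRecord F N) (ZtOfRecord F N)) lamW
    (hasResidualsOfRecord_theta13OfNumerics F N (stage12NumericsOfThm1C F.L ε₀ B₃ a₀ a₁) ε₂₉) h
    (admissible_theta13OfNumerics F N (zeta316OfRecord F N (stage12NumericsOfThm1C F.L ε₀ B₃ a₀ a₁).ν (stage12NumericsOfThm1C F.L ε₀ B₃ a₀ a₁).τ9.M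
      (stage12NumericsOfThm1C F.L ε₀ B₃ a₀ a₁).A₁) (RzOfRecord F N) (ZtOfRecord F N) (stage12NumericsOfThm1C_pos hε hB ha₀ ha₁) hε')
    h12pin h12mass h12P1 h12i180 h12c189

end CuredThm1C

end Summit.QuantumFields.YangMills.BalabanUVNodes.N12AtRecord13CoPR
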